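import Literature.MathematicalPhysics.KineticTheory.HardSphereUniformGas
import HarnessLib

/-!
# Uniform law of large numbers for the mollified empirical density of the uniform hard-sphere gas

Topic `Literature/MathematicalPhysics/KineticTheory` (kind proof; companion of `HardSphereUniformGas.lean`,
static input of the TUBE side of the Enskog closure at rung 0, crux line `even-rung-mean-variance` of
`JParityClosure.EvenStressEnskog`, stmt-AtomisticToContinuum-13079).

For `N + 1` hard spheres of diameter `σ(N+1)^{-1/3}` on `𝕋³` under the configurational canonical Gibbs
measure `P_N = posGibbsMeasure a ε_N (N+1)` with constant activity, and the cone-mollified empirical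
density `ρ̃_r(x, y) = (N+1)⁻¹ Σₖ b_r(xₖ, y)` (`coneKernel`, total mass `1` for `r < 1/2`):

  `P_N {x | ∃ y, δ ≤ |ρ̃_r(x, y) − 1|} → 0` as `N → ∞` (`tendsto_posGibbs_exists_density_dev`),

for small reduced density (`SmallDensity uniformProfile σ`).  In particular the density read AT the
particles, `ρ̃_r(x, xᵢ)`, is uniformly close to `1` with high probability.  Proof: (i) at each point `y`
the variance `∫ (ρ̃_r(x,y) − 1)² dP_N → 0` (`tendsto_variance_uniform`, `∫ b_r(·, y) = 1`); (ii)
integrating over `y ∈ 𝕋³` (dominated convergence) `W_N = ∫∫ (ρ̃_r − 1)² dy dP_N → 0`; (iii) `ρ̃_r(x, ·)`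
is `3/(πr⁴)`-Lipschitz for the minimal-image distance, uniformly in `x`, so a deviation `≥ δ` at one point
forces `∫ (ρ̃_r(x,y) − 1)² dy ≥ (δ/2)² · vol(B_ρ)`; (iv) Markov's inequality.

References: H. Spohn, *Large Scale Dynamics of Interacting Particles* (1991), Part I §2.3 [Spohn1991].
-/

noncomputable section

namespace Literature.MathematicalPhysics.KineticTheory

open _root_.MeasureTheory _root_.ProbabilityTheory Set Filter _root_.Topology Function
open scoped ENNReal BigOperators
open Literature.Analysis.FluidPDE

/-! ## The cone kernel: range and Lipschitz continuity -/

/-- `0 ≤ b_r(x, y) ≤ 3/(πr³)` for `r > 0`. [folklore] -/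
theorem coneKernel_mem_Icc {r : ℝ} (hr : 0 < r) (x y : UnitAddTorus (Fin 3)) :
    coneKernel r x y ∈ Icc (0 : ℝ) (3 / (Real.pi * r ^ 3)) := by
  have hM : 0 ≤ 3 / (Real.pi * r ^ 3) := by positivity
  have hd : 0 ≤ Torus.euclidDist x y := norm_nonneg _
  unfold coneKernel
  refine ⟨mul_nonneg hM (le_max_right _ _), ?_⟩
  have h1 : max (1 - Torus.euclidDist x y / r) 0 ≤ 1 := max_le (by linarith [div_nonneg hd hr.le]) zero_le_one
  calc 3 / (Real.pi * r ^ 3) * max (1 - Torus.euclidDist x y / r) 0 ≤ 3 / (Real.pi * r ^ 3) * 1 :=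
        mul_le_mul_of_nonneg_left h1 hM
    _ = 3 / (Real.pi * r ^ 3) := mul_one _

/-- The minimal-image distance satisfies the triangle inequality. [folklore] -/
theorem euclidDist_triangle' (x y z : UnitAddTorus (Fin 3)) :
    Torus.euclidDist x z ≤ Torus.euclidDist x y + Torus.euclidDist y z := by
  unfold Torus.euclidDist
  have hproj : Literature.Analysis.FunctionSpaces.Torus.proj (Torus.reprSym (x - y) + Torus.reprSym (y - z)) =
      x - z := by
    rw [Literature.Analysis.FunctionSpaces.Torus.proj_add, Torus.proj_reprSym, Torus.proj_reprSym]; abel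
  exact (Torus.norm_reprSym_le_of_proj_eq hproj).trans (norm_add_le _ _)

/-- The minimal-image distance to a fixed point is `1`-Lipschitz. [folklore] -/
theorem abs_euclidDist_sub_euclidDist_le (x y y' : UnitAddTorus (Fin 3)) :
    |Torus.euclidDist x y - Torus.euclidDist x y'| ≤ Torus.euclidDist y y' := by
  rw [abs_sub_le_iff]
  constructor
  · have := euclidDist_triangle' x y' y
    rw [Torus.euclidDist_comm y' y] at this
    linarith
  · have := euclidDist_triangle' x y y'
    linarith

/-- **The cone kernel is Lipschitz in its second argument**: `|b_r(x,y) − b_r(x,y')| ≤ 3/(πr⁴) · d(y,y')`.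
[folklore] -/
theorem abs_coneKernel_sub_le {r : ℝ} (hr : 0 < r) (x y y' : UnitAddTorus (Fin 3)) :
    |coneKernel r x y - coneKernel r x y'| ≤ 3 / (Real.pi * r ^ 4) * Torus.euclidDist y y' := by
  have hM : 0 ≤ 3 / (Real.pi * r ^ 3) := by positivity
  unfold coneKernel
  rw [← mul_sub, abs_mul, abs_of_nonneg hM]
  have h1 : |max (1 - Torus.euclidDist x y / r) 0 - max (1 - Torus.euclidDist x y' / r) 0| ≤
      Torus.euclidDist y y' / r := by
    refine (abs_max_sub_max_le_abs _ _ _).trans ?_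
    rw [show (1 - Torus.euclidDist x y / r) - (1 - Torus.euclidDist x y' / r) =
      (Torus.euclidDist x y' - Torus.euclidDist x y) / r by ring, abs_div, abs_of_pos hr]
    exact div_le_div_of_nonneg_right
      ((abs_euclidDist_sub_euclidDist_le x y' y).trans_eq (Torus.euclidDist_comm y' y)) hr.le
  calc 3 / (Real.pi * r ^ 3) * |max (1 - Torus.euclidDist x y / r) 0 - max (1 - Torus.euclidDist x y' / r) 0|
      ≤ 3 / (Real.pi * r ^ 3) * (Torus.euclidDist y y' / r) := mul_le_mul_of_nonneg_left h1 hM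
    _ = 3 / (Real.pi * r ^ 4) * Torus.euclidDist y y' := by field_simp

/-! ## The mollified empirical density of a configuration of positions -/

/-- The cone-mollified empirical density of `n` positions at `y`: `ρ̃_r(x, y) = n⁻¹ Σₖ b_r(xₖ, y)`.
[folklore] -/
def empDensity {n : ℕ} (r : ℝ) (x : Fin n → T3) (y : T3) : ℝ :=
  ((n : ℕ) : ℝ)⁻¹ * ∑ k, coneKernel r (x k) y

/-- The mollified empirical density is jointly continuous. [folklore] -/
theorem continuous_empDensity {n : ℕ} (r : ℝ) : Continuous (uncurry (empDensity (n := n) r)) := by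
  have hck : ∀ k : Fin n, Continuous fun p : (Fin n → T3) × T3 => coneKernel r (p.1 k) p.2 := by
    intro k
    have hd : Continuous fun p : (Fin n → T3) × T3 => Torus.euclidDist (p.1 k) p.2 := by
      simp only [euclidDist_eq_sqrt]
      fun_prop
    unfold coneKernel
    fun_prop
  show Continuous fun p : (Fin n → T3) × T3 => ((n : ℕ) : ℝ)⁻¹ * ∑ k, coneKernel r (p.1 k) p.2
  fun_prop

/-- The mollified empirical density is jointly measurable (minimal-image chart `reprSym`). [folklore] -/
theorem measurable_empDensity {n : ℕ} (r : ℝ) : Measurable (uncurry (empDensity (n := n) r)) := by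
  have hk : ∀ k : Fin n, Measurable fun p : (Fin n → T3) × T3 => coneKernel r (p.1 k) p.2 := by
    intro k
    have h1 : Measurable fun p : (Fin n → T3) × T3 => p.1 k - p.2 :=
      ((measurable_pi_apply k).comp measurable_fst).sub measurable_snd
    have hd : Measurable fun p : (Fin n → T3) × T3 => Torus.euclidDist (p.1 k) p.2 := by
      simp only [Torus.euclidDist_eq]
      have h2 := (Torus.measurable_reprSym.comp h1).norm
      exact h2
    unfold coneKernel
    exact measurable_const.mul ((measurable_const.sub (hd.div_const r)).max measurable_const)
  show Measurable fun p : (Fin n → T3) × T3 => ((n : ℕ) : ℝ)⁻¹ * ∑ k, coneKernel r (p.1 k) p.2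
  exact measurable_const.mul (Finset.measurable_sum _ fun k _ => hk k)

/-- The squared deviation `(ρ̃_r − 1)²` is jointly measurable. [folklore] -/
theorem measurable_sq_empDensity_sub_one {n : ℕ} (r : ℝ) :
    Measurable fun p : (Fin n → T3) × T3 => (empDensity r p.1 p.2 - 1) ^ 2 :=
  ((measurable_empDensity r).sub measurable_const).pow_const 2

/-- `0 ≤ ρ̃_r ≤ 3/(πr³)`. [folklore] -/
theorem empDensity_mem_Icc {n : ℕ} {r : ℝ} (hr : 0 < r) (x : Fin n → T3) (y : T3) :
    empDensity r x y ∈ Icc (0 : ℝ) (3 / (Real.pi * r ^ 3)) := by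
  unfold empDensity
  have hn0 : 0 ≤ ((n : ℕ) : ℝ)⁻¹ := by positivity
  refine ⟨mul_nonneg hn0 (Finset.sum_nonneg fun k _ => (coneKernel_mem_Icc hr _ _).1), ?_⟩
  rcases Nat.eq_zero_or_pos n with h0 | hpos
  · subst h0
    simp only [Finset.univ_eq_empty, Finset.sum_empty, mul_zero]
    positivity
  calc ((n : ℕ) : ℝ)⁻¹ * ∑ k, coneKernel r (x k) y ≤ ((n : ℕ) : ℝ)⁻¹ * ∑ _k : Fin n, 3 / (Real.pi * r ^ 3) :=
        mul_le_mul_of_nonneg_left (Finset.sum_le_sum fun k _ => (coneKernel_mem_Icc hr _ _).2) hn0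
    _ = 3 / (Real.pi * r ^ 3) := by
        rw [Finset.sum_const, Finset.card_univ, Fintype.card_fin, nsmul_eq_mul, ← mul_assoc,
          inv_mul_cancel₀ (by exact_mod_cast hpos.ne'), one_mul]

/-- **`ρ̃_r(x, ·)` is `3/(πr⁴)`-Lipschitz for the minimal-image distance**, uniformly in `x`. [folklore] -/
theorem abs_empDensity_sub_le {n : ℕ} {r : ℝ} (hr : 0 < r) (x : Fin n → T3) (y y' : T3) :
    |empDensity r x y - empDensity r x y'| ≤ 3 / (Real.pi * r ^ 4) * Torus.euclidDist y y' := by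
  unfold empDensity
  have hn0 : 0 ≤ ((n : ℕ) : ℝ)⁻¹ := by positivity
  have hK : 0 ≤ 3 / (Real.pi * r ^ 4) * Torus.euclidDist y y' := mul_nonneg (by positivity) (norm_nonneg _)
  rw [← mul_sub, ← Finset.sum_sub_distrib, abs_mul, abs_of_nonneg hn0]
  rcases Nat.eq_zero_or_pos n with h0 | hpos
  · subst h0
    simp only [Finset.univ_eq_empty, Finset.sum_empty, abs_zero, mul_zero]
    exact hK
  calc ((n : ℕ) : ℝ)⁻¹ * |∑ k, (coneKernel r (x k) y - coneKernel r (x k) y')|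
      ≤ ((n : ℕ) : ℝ)⁻¹ * ∑ k, |coneKernel r (x k) y - coneKernel r (x k) y'| :=
        mul_le_mul_of_nonneg_left (Finset.abs_sum_le_sum_abs _ _) hn0
    _ ≤ ((n : ℕ) : ℝ)⁻¹ * ∑ _k : Fin n, 3 / (Real.pi * r ^ 4) * Torus.euclidDist y y' :=
        mul_le_mul_of_nonneg_left (Finset.sum_le_sum fun k _ => abs_coneKernel_sub_le hr _ _ _) hn0
    _ = 3 / (Real.pi * r ^ 4) * Torus.euclidDist y y' := by
        rw [Finset.sum_const, Finset.card_univ, Fintype.card_fin, nsmul_eq_mul, ← mul_assoc,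
          inv_mul_cancel₀ (by exact_mod_cast hpos.ne'), one_mul]

/-! ## A deviation at one point forces an `L²` deviation -/

/-- **A deviation at one point forces an `L²(𝕋³)` deviation.**  If `δ ≤ |ρ̃_r(x, y₀) − 1|` then
`(δ/2)² · vol(B(0, ρ)) ≤ ∫ (ρ̃_r(x, y) − 1)² dy` with `ρ = min (δ πr⁴/6) (1/4)` (Lipschitz continuity:
the deviation stays `≥ δ/2` on the minimal-image ball of radius `ρ` about `y₀`, whose Haar measure is
that of the Euclidean ball). [folklore] -/
theorem sq_mul_volume_ball_le_integral_sq {n : ℕ} {r : ℝ} (hr : 0 < r) {δ : ℝ} (hδ : 0 < δ)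
    (x : Fin n → T3) {y₀ : T3} (hdev : δ ≤ |empDensity r x y₀ - 1|) :
    (δ / 2) ^ 2 * (volume (Metric.ball (0 : EuclideanSpace ℝ (Fin 3))
        (min (δ * (Real.pi * r ^ 4) / 6) (1 / 4)))).toReal ≤
      ∫ y, (empDensity r x y - 1) ^ 2 := by
  set K : ℝ := 3 / (Real.pi * r ^ 4) with hK
  have hK0 : 0 < K := by positivity
  set ρ : ℝ := min (δ * (Real.pi * r ^ 4) / 6) (1 / 4) with hρ
  have hρ0 : 0 < ρ := lt_min (by positivity) (by norm_num)
  have hρhalf : ρ < 1 / 2 := (min_le_right _ _).trans_lt (by norm_num)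
  have hKρ : K * ρ ≤ δ / 2 := by
    calc K * ρ ≤ K * (δ * (Real.pi * r ^ 4) / 6) := mul_le_mul_of_nonneg_left (min_le_left _ _) hK0.le
      _ = δ / 2 := by rw [hK]; field_simp; ring
  set B : Set T3 := {y | Torus.euclidDist y y₀ < ρ} with hB
  have hBm : MeasurableSet B := by
    rw [hB]
    simp only [Torus.euclidDist_eq]
    exact measurableSet_lt ((Torus.measurable_reprSym.comp (measurable_id.sub measurable_const)).norm)
      measurable_const
  have hvolB : volume B = volume (Metric.ball (0 : EuclideanSpace ℝ (Fin 3)) ρ) := Torus.volume_euclidDist_lt hρhalf y₀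
  -- on `B` the deviation is at least `δ/2`
  have hdevB : ∀ y ∈ B, (δ / 2) ^ 2 ≤ (empDensity r x y - 1) ^ 2 := by
    intro y hy
    have hlip := abs_empDensity_sub_le hr x y y₀
    have hy' : K * Torus.euclidDist y y₀ ≤ δ / 2 :=
      (mul_le_mul_of_nonneg_left (le_of_lt hy) hK0.le).trans hKρ
    have h1 : δ / 2 ≤ |empDensity r x y - 1| := by
      have htri : |empDensity r x y₀ - 1| ≤ |empDensity r x y - 1| + |empDensity r x y - empDensity r x y₀| := by
        calc |empDensity r x y₀ - 1| = |(empDensity r x y - 1) - (empDensity r x y - empDensity r x y₀)| := by ring_nf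
          _ ≤ |empDensity r x y - 1| + |empDensity r x y - empDensity r x y₀| := abs_sub _ _
      linarith
    have h2 : (δ / 2) ^ 2 ≤ |empDensity r x y - 1| ^ 2 := pow_le_pow_left₀ (by positivity) h1 2
    rwa [sq_abs] at h2
  -- integrate
  have hcont : Continuous fun y => (empDensity r x y - 1) ^ 2 := by
    have h := (continuous_empDensity (n := n) r).comp (Continuous.prodMk_right x)
    exact (h.sub continuous_const).pow 2
  have hint : Integrable (fun y => (empDensity r x y - 1) ^ 2) (volume : Measure T3) :=
    hcont.integrable_of_hasCompactSupport (isClosed_tsupport _).isCompact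
  have hind : Integrable (B.indicator fun _ => (δ / 2) ^ 2) (volume : Measure T3) :=
    (integrable_const _).indicator hBm
  calc (δ / 2) ^ 2 * (volume (Metric.ball (0 : EuclideanSpace ℝ (Fin 3)) ρ)).toReal
      = ∫ y, B.indicator (fun _ => (δ / 2) ^ 2) y := by
        rw [integral_indicator hBm, setIntegral_const, smul_eq_mul, mul_comm, measureReal_def, hvolB]
    _ ≤ ∫ y, (empDensity r x y - 1) ^ 2 := by
        refine integral_mono hind hint fun y => ?_
        by_cases hy : y ∈ B
        · rw [indicator_of_mem hy]; exact hdevB y hy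
        · rw [indicator_of_notMem hy]; positivity

/-! ## The variance at a point and the integrated variance -/

section Variance

variable {σ : ℝ} (h : SmallDensity uniformProfile σ)
include h

/-- **The variance of the mollified density at a point tends to zero** under the uniform gas at small
reduced density (`tendsto_variance_uniform` with `∫ b_r(·, y) = 1`, rewritten on `posGibbsMeasure`).
[folklore] -/
theorem tendsto_integral_sq_empDensity_sub_one {a : ℝ} (ha : 0 < a) {r : ℝ} (hr : 0 < r) (hr2 : r < 1 / 2)
    (y : T3) :
    Tendsto (fun N : ℕ => ∫ x, (empDensity r x y - 1) ^ 2
      ∂posGibbsMeasure (fun _ : T3 => a) (hsDiameter σ N) (N + 1)) atTop (𝓝 0) := by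
  have hbc : Continuous fun y' : T3 => coneKernel r y' y := by
    have hd : Continuous fun y' : T3 => Torus.euclidDist y' y := by
      simp only [euclidDist_eq_sqrt]; fun_prop
    unfold coneKernel; fun_prop
  have h1 := tendsto_variance_uniform h hbc
  rw [integral_coneKernel hr hr2 y] at h1
  refine h1.congr fun N => ?_
  rw [integral_posGibbsMeasure_const ha, div_eq_inv_mul]
  rfl

/-- **The integrated variance tends to zero**: `∫∫ (ρ̃_r(x,y) − 1)² dy dP_N → 0` (Fubini and dominated
convergence over the compact torus). [folklore] -/
theorem tendsto_integral_integral_sq_empDensity_sub_one {a : ℝ} (ha : 0 < a) {r : ℝ} (hr : 0 < r)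
    (hr2 : r < 1 / 2) :
    Tendsto (fun N : ℕ => ∫ x, (∫ y : T3, (empDensity r x y - 1) ^ 2)
      ∂posGibbsMeasure (fun _ : T3 => a) (hsDiameter σ N) (N + 1)) atTop (𝓝 0) := by
  set M : ℝ := 3 / (Real.pi * r ^ 3) with hM
  have hM0 : 0 ≤ M := by positivity
  haveI hprob : ∀ N : ℕ, IsProbabilityMeasure (posGibbsMeasure (fun _ : T3 => a) (hsDiameter σ N) (N + 1)) :=
    fun N => isProbabilityMeasure_posGibbsMeasure continuous_const (fun _ => ha) h.σ_lt_half.le N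
  -- the integrand, jointly measurable and bounded
  have hFm : ∀ N : ℕ, Measurable fun p : (Fin (N + 1) → T3) × T3 => (empDensity r p.1 p.2 - 1) ^ 2 :=
    fun N => measurable_sq_empDensity_sub_one r
  have hFb : ∀ (N : ℕ) (x : Fin (N + 1) → T3) (y : T3), |(empDensity r x y - 1) ^ 2| ≤ (M + 1) ^ 2 := by
    intro N x y
    obtain ⟨h0, h1⟩ := empDensity_mem_Icc hr x y
    rw [abs_of_nonneg (sq_nonneg _), ← sq_abs]
    refine pow_le_pow_left₀ (abs_nonneg _) ?_ 2
    rw [abs_le]; constructor <;> linarith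
  -- Fubini
  have hswap : ∀ N : ℕ, ∫ x, (∫ y : T3, (empDensity r x y - 1) ^ 2)
      ∂posGibbsMeasure (fun _ : T3 => a) (hsDiameter σ N) (N + 1) =
      ∫ y : T3, ∫ x, (empDensity r x y - 1) ^ 2 ∂posGibbsMeasure (fun _ : T3 => a) (hsDiameter σ N) (N + 1) := by
    intro N
    refine integral_integral_swap ?_
    refine Integrable.of_bound (hFm N).aestronglyMeasurable ((M + 1) ^ 2) (ae_of_all _ fun p => ?_)
    rw [Real.norm_eq_abs]
    exact hFb N p.1 p.2
  simp_rw [hswap]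
  -- dominated convergence over `y`
  have hmeas : ∀ N : ℕ, AEStronglyMeasurable (fun y : T3 => ∫ x, (empDensity r x y - 1) ^ 2
      ∂posGibbsMeasure (fun _ : T3 => a) (hsDiameter σ N) (N + 1)) volume := by
    intro N
    have hsw : Measurable (uncurry fun (y : T3) (x : Fin (N + 1) → T3) => (empDensity r x y - 1) ^ 2) := by
      have h' := (hFm N).comp measurable_swap
      exact h'
    have h' := hsw.stronglyMeasurable.integral_prod_right'
      (ν := posGibbsMeasure (fun _ : T3 => a) (hsDiameter σ N) (N + 1))
    exact h'.aestronglyMeasurable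
  have hbound : ∀ N : ℕ, ∀ᵐ y : T3 ∂volume, ‖∫ x, (empDensity r x y - 1) ^ 2
      ∂posGibbsMeasure (fun _ : T3 => a) (hsDiameter σ N) (N + 1)‖ ≤ (M + 1) ^ 2 := by
    intro N
    refine ae_of_all _ fun y => ?_
    have h' := norm_integral_le_of_norm_le_const (μ := posGibbsMeasure (fun _ : T3 => a) (hsDiameter σ N) (N + 1))
      (f := fun x => (empDensity r x y - 1) ^ 2) (C := (M + 1) ^ 2)
      (ae_of_all _ fun x => by rw [Real.norm_eq_abs]; exact hFb N x y)
    simpa only [probReal_univ, mul_one] using h'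
  have hlim : ∀ᵐ y : T3 ∂volume, Tendsto (fun N : ℕ => ∫ x, (empDensity r x y - 1) ^ 2
      ∂posGibbsMeasure (fun _ : T3 => a) (hsDiameter σ N) (N + 1)) atTop (𝓝 0) :=
    ae_of_all _ fun y => tendsto_integral_sq_empDensity_sub_one h ha hr hr2 y
  have hD := tendsto_integral_of_dominated_convergence (fun _ => (M + 1) ^ 2) hmeas (integrable_const _) hbound hlim
  simpa only [integral_zero] using hD

/-! ## The uniform law of large numbers -/

/-- **Uniform law of large numbers for the mollified density of the uniform hard-sphere gas.**  At small
reduced density, for `0 < r < 1/2` and every `δ > 0`,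
`P_N {x | ∃ y, δ ≤ |ρ̃_r(x, y) − 1|} → 0` (a deviation at one point forces an `L²(𝕋³)` deviation
`≥ (δ/2)² vol(B_ρ)`, whose probability is controlled by Markov's inequality and the integrated variance).
[folklore] -/
theorem tendsto_posGibbs_exists_density_dev {a : ℝ} (ha : 0 < a) {r : ℝ} (hr : 0 < r) (hr2 : r < 1 / 2)
    {δ : ℝ} (hδ : 0 < δ) :
    Tendsto (fun N : ℕ => posGibbsMeasure (fun _ : T3 => a) (hsDiameter σ N) (N + 1)
      {x | ∃ y : T3, δ ≤ |empDensity r x y - 1|}) atTop (𝓝 0) := by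
  haveI hprob : ∀ N : ℕ, IsProbabilityMeasure (posGibbsMeasure (fun _ : T3 => a) (hsDiameter σ N) (N + 1)) :=
    fun N => isProbabilityMeasure_posGibbsMeasure continuous_const (fun _ => ha) h.σ_lt_half.le N
  set M : ℝ := 3 / (Real.pi * r ^ 3) with hM
  set ρ : ℝ := min (δ * (Real.pi * r ^ 4) / 6) (1 / 4) with hρ
  have hρ0 : 0 < ρ := lt_min (by positivity) (by norm_num)
  set c : ℝ := (δ / 2) ^ 2 * (volume (Metric.ball (0 : EuclideanSpace ℝ (Fin 3)) ρ)).toReal with hc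
  have hc0 : 0 < c := by
    refine mul_pos (by positivity) (ENNReal.toReal_pos (Metric.measure_ball_pos volume _ hρ0).ne' measure_ball_lt_top.ne)
  -- the integrated square deviation of a configuration
  set I : (N : ℕ) → (Fin (N + 1) → T3) → ℝ := fun N x => ∫ y, (empDensity r x y - 1) ^ 2 with hI
  have hFm : ∀ N : ℕ, Measurable fun p : (Fin (N + 1) → T3) × T3 => (empDensity r p.1 p.2 - 1) ^ 2 :=
    fun N => measurable_sq_empDensity_sub_one r
  have hFb : ∀ (N : ℕ) (x : Fin (N + 1) → T3) (y : T3), |(empDensity r x y - 1) ^ 2| ≤ (M + 1) ^ 2 := by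
    intro N x y
    obtain ⟨h0, h1⟩ := empDensity_mem_Icc hr x y
    rw [abs_of_nonneg (sq_nonneg _), ← sq_abs]
    refine pow_le_pow_left₀ (abs_nonneg _) ?_ 2
    rw [abs_le]; constructor <;> linarith
  have hIm : ∀ N : ℕ, Measurable (I N) := fun N => by
    have h' := (hFm N).stronglyMeasurable.integral_prod_right' (ν := (volume : Measure T3))
    exact h'.measurable
  have hI0 : ∀ N x, 0 ≤ I N x := fun N x => integral_nonneg fun y => sq_nonneg _
  have hIb : ∀ N x, I N x ≤ (M + 1) ^ 2 := fun N x => by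
    have h' := norm_integral_le_of_norm_le_const (μ := (volume : Measure T3))
      (f := fun y => (empDensity r x y - 1) ^ 2) (C := (M + 1) ^ 2)
      (ae_of_all _ fun y => by rw [Real.norm_eq_abs]; exact hFb N x y)
    rw [probReal_univ, mul_one, Real.norm_eq_abs] at h'
    exact (le_abs_self _).trans h'
  have hIint : ∀ N : ℕ, Integrable (I N) (posGibbsMeasure (fun _ : T3 => a) (hsDiameter σ N) (N + 1)) :=
    fun N => Integrable.of_bound (hIm N).aestronglyMeasurable ((M + 1) ^ 2)
      (ae_of_all _ fun x => by rw [Real.norm_eq_abs, abs_of_nonneg (hI0 N x)]; exact hIb N x)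
  -- the bad event lies in `{c ≤ I}`
  have hsub : ∀ N : ℕ, {x : Fin (N + 1) → T3 | ∃ y : T3, δ ≤ |empDensity r x y - 1|} ⊆ {x | c ≤ I N x} := by
    intro N x hx
    obtain ⟨y₀, hy₀⟩ := hx
    exact sq_mul_volume_ball_le_integral_sq hr hδ x hy₀
  -- Markov
  have hW := tendsto_integral_integral_sq_empDensity_sub_one h ha hr hr2
  have hbd : ∀ N : ℕ, posGibbsMeasure (fun _ : T3 => a) (hsDiameter σ N) (N + 1)
      {x | ∃ y : T3, δ ≤ |empDensity r x y - 1|} ≤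
      ENNReal.ofReal ((∫ x, I N x ∂posGibbsMeasure (fun _ : T3 => a) (hsDiameter σ N) (N + 1)) / c) := by
    intro N
    refine (measure_mono (hsub N)).trans ?_
    have hmk := mul_meas_ge_le_integral_of_nonneg (ae_of_all _ (hI0 N)) (hIint N) c
    rw [← ENNReal.ofReal_toReal (measure_ne_top _ {x | c ≤ I N x})]
    refine ENNReal.ofReal_le_ofReal ?_
    rw [le_div_iff₀ hc0, mul_comm]
    exact hmk
  have hlim : Tendsto (fun N : ℕ => ENNReal.ofReal
      ((∫ x, I N x ∂posGibbsMeasure (fun _ : T3 => a) (hsDiameter σ N) (N + 1)) / c)) atTop (𝓝 0) := by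
    have := ENNReal.tendsto_ofReal (hW.div_const c)
    rwa [zero_div, ENNReal.ofReal_zero] at this
  exact tendsto_of_tendsto_of_tendsto_of_le_of_le tendsto_const_nhds hlim (fun _ => zero_le) hbd

end Variance

/-- **Uniform LLN, quantified form**: for every `δ, η > 0` there is `N₀` with
`P_N {x | ∃ y, δ ≤ |ρ̃_r(x,y) − 1|} ≤ η` for `N ≥ N₀`. [folklore] -/
theorem exists_posGibbs_exists_density_dev_le {σ : ℝ} (h : SmallDensity uniformProfile σ) {a : ℝ}
    (ha : 0 < a) {r : ℝ} (hr : 0 < r) (hr2 : r < 1 / 2) {δ : ℝ} (hδ : 0 < δ) {η : ℝ} (hη : 0 < η) :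
    ∃ N₀ : ℕ, ∀ N : ℕ, N₀ ≤ N → (posGibbsMeasure (fun _ : T3 => a) (hsDiameter σ N) (N + 1)).real
      {x | ∃ y : T3, δ ≤ |empDensity r x y - 1|} ≤ η := by
  have ht := tendsto_posGibbs_exists_density_dev h ha hr hr2 hδ
  have hev : ∀ᶠ N in atTop, posGibbsMeasure (fun _ : T3 => a) (hsDiameter σ N) (N + 1)
      {x | ∃ y : T3, δ ≤ |empDensity r x y - 1|} < ENNReal.ofReal η :=
    ht (Iio_mem_nhds (by simpa using hη))
  obtain ⟨N₀, hN₀⟩ := eventually_atTop.1 hev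
  refine ⟨N₀, fun N hN => ?_⟩
  have h' := (hN₀ N hN).le
  rw [measureReal_def]
  exact (ENNReal.toReal_mono ENNReal.ofReal_ne_top h').trans_eq (ENNReal.toReal_ofReal hη.le)

end Literature.MathematicalPhysics.KineticTheory

end
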